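import Literature.AlgebraicGeometry.HodgeTheory.VHSDataHodgeClassesAlongSubvariations
import HarnessLib

/-!
# Schur's lemma for morphisms of VHS data under IRREDUCIBLE MONODROMY: the kernel and the image of `(φ_s)_ℚ` are monodromy-stable rational subspaces, so
# a morphism out of (into) VHS data with irreducible monodromy at `s` is ZERO or lattice-INJECTIVE (zero or rationally SURJECTIVE); on a path-connected base
# the dichotomy holds at every point, and a nonzero morphism between VHS data with irreducible monodromies is a rational isomorphism on every fibre

Topic `Literature/AlgebraicGeometry/HodgeTheory` (namespace `Literature.AlgebraicGeometry.Motives.VHSData`), lane `lit-hodgefound` (seat `p08`, row g61-#21); companion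
of `VHSDataGenericHodgeClassesIrreducibleMonodromy` (the same irreducibility hypothesis: every loop-stable rational subspace of `V_s` is `0` or `V_s`), built on
`VHSDataChartsIso` (`Hom.appRat_transport`: `φ_ℚ` commutes with the rational transport), `VHSDataHodgeClassesAlongSubvariations` (`injective_homRat_of_injective`,
`Hom.injective_app_of_injective_app`, `exceptionalHodgeLocus_subset_of_forall_injective`) and `Motives/FamiliesVHSMorphism` (`appRat_toRat`, rigidity).  THEOREMS
ONLY — no definition, no named fact, no instance (D-0026 net debt `0`).

PRINTED SOURCES.  C. Voisin, *Hodge Theory II*, §3.1.1 (local systems ↔ representations of `π₁`, Cor. 3.10: morphisms of local systems = equivariant maps of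
the fibres) and Thm. 3.4 ∕ Cor. 3.28 (irreducible monodromy); P. Deligne, LNM 163 (1970), I.1, Cor. 1.4; P. Deligne, *Théorie de Hodge II*, 4.2 (semi-simplicity
and Schur-type statements for variations); the dichotomy itself is Schur's lemma for the `π₁(S, s)`-module `V_s` [folklore].

CONTENT (`φ : Hom D₁ D₂`; irreducibility of the monodromy of `D₁`, resp. `D₂`, at `s`).
* §1 `Hom.map_transport_ker_appRat_le`, `Hom.map_transport_range_appRat_le` (kernel and image of `(φ_s)_ℚ` are monodromy-stable — indeed transported onto the
  kernel ∕ image at `t`).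
* §2 **`Hom.appRat_eq_zero_or_injective_of_irreducible`** (source irreducible: `(φ_s)_ℚ = 0` or injective), **`Hom.app_eq_zero_or_injective_of_irreducible`**
  (the lattice form), **`Hom.range_appRat_eq_bot_or_eq_top_of_irreducible`** (target irreducible: `(φ_s)_ℚ = 0` or surjective),
  **`Hom.appRat_eq_zero_or_bijective_of_irreducible`** (both: zero or a rational isomorphism).
* §3 PATH-CONNECTED BASE: `Hom.app_eq_zero_of_app_eq_zero` (vanishing propagates), **`Hom.forall_app_eq_zero_or_forall_injective_of_irreducible`**,
  **`exceptionalHodgeLocus_subset_of_ne_zero_of_irreducible`** (a NONZERO morphism out of VHS data with irreducible monodromy embeds the exceptional Hodge loci: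
  `exceptionalHodgeLocus D₁ p ⊆ exceptionalHodgeLocus D₂ p`, by the sub-variation theorem).

HONEST SCOPE.  Hypothesis structure `VHSData`; irreducibility is the hypothesis of `VHSDataGenericHodgeClassesIrreducibleMonodromy` (rational, at one point);
no semi-simplicity theorem is claimed.

## References

* [VoisinHodgeII2003] C. Voisin, *Hodge Theory and Complex Algebraic Geometry II*, CUP (2003), §3.1.1 (Cor. 3.10), Thm. 3.4, §3.2.3 (Cor. 3.28).
* [Deligne1970] P. Deligne, *Équations différentielles à points singuliers réguliers*, LNM 163 (1970), I.1, Cor. 1.4.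
* [DeligneHodgeII1971] P. Deligne, *Théorie de Hodge II*, Publ. Math. IHÉS 40 (1971), 4.2.
* [Schmid1973] W. Schmid, *Variation of Hodge structure: the singularities of the period mapping*, Invent. Math. 22 (1973), §2.
-/

noncomputable section

open _root_.Topology _root_.Filter Set

namespace Literature.AlgebraicGeometry

open Motives Motives.HodgeStructure HodgeTheory Topology

namespace Motives.VHSData

variable {S : Type} [TopologicalSpace S] {k : ℤ} {D₁ D₂ : VHSData S k}

/-! ## §1 Kernel and image of `φ_ℚ` are monodromy-stable -/

/-- **The kernels of `(φ_s)_ℚ` are carried into each other by transport** (so `ker (φ_s)_ℚ` is stable under the monodromy at `s`).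
[cite: VoisinHodgeII2003, §3.1.1 (Cor. 3.10)] [cite: Deligne1970, I.1] -/
theorem Hom.map_transport_ker_appRat_le (φ : Hom D₁ D₂) {s t : S} (γ : Path.Homotopic.Quotient s t) :
    (LinearMap.ker (φ.appRat s)).map (D₁.V.transport γ) ≤ LinearMap.ker (φ.appRat t) := by
  rintro _ ⟨x, hx, rfl⟩
  rw [SetLike.mem_coe, LinearMap.mem_ker] at hx
  rw [LinearMap.mem_ker, φ.appRat_transport γ, hx, map_zero]

/-- **The images of `(φ_s)_ℚ` are carried into each other by transport** (so `im (φ_s)_ℚ` is stable under the monodromy at `s`).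
[cite: VoisinHodgeII2003, §3.1.1 (Cor. 3.10)] [cite: Deligne1970, I.1] -/
theorem Hom.map_transport_range_appRat_le (φ : Hom D₁ D₂) {s t : S} (γ : Path.Homotopic.Quotient s t) :
    (LinearMap.range (φ.appRat s)).map (D₂.V.transport γ) ≤ LinearMap.range (φ.appRat t) := by
  rintro _ ⟨_, ⟨x, rfl⟩, rfl⟩
  exact ⟨D₁.V.transport γ x, φ.appRat_transport γ x⟩

/-! ## §2 Schur's dichotomies at `s` -/

/-- **SCHUR (source irreducible): `(φ_s)_ℚ = 0` OR `(φ_s)_ℚ` IS INJECTIVE.** [cite: VoisinHodgeII2003, §3.1.1 (Cor. 3.10) and Thm. 3.4] [cite: DeligneHodgeII1971, 4.2] -/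
theorem Hom.appRat_eq_zero_or_injective_of_irreducible (φ : Hom D₁ D₂) {s : S}
    (hirr : ∀ U : Submodule ℚ (D₁.V.fiber s), (∀ γ : Path.Homotopic.Quotient s s, U.map (D₁.V.transport γ) ≤ U) → U = ⊥ ∨ U = ⊤) :
    φ.appRat s = 0 ∨ Function.Injective (φ.appRat s) := by
  rcases hirr _ (fun γ => φ.map_transport_ker_appRat_le γ) with h | h
  · exact Or.inr (LinearMap.ker_eq_bot.1 h)
  · exact Or.inl (LinearMap.ker_eq_top.1 h)

/-- **The lattice form: `φ_s = 0` or `φ_s` is injective.** [cite: VoisinHodgeII2003, §3.1.1 (Cor. 3.10) and Thm. 3.4] [cite: Schmid1973, §2] -/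
theorem Hom.app_eq_zero_or_injective_of_irreducible (φ : Hom D₁ D₂) {s : S}
    (hirr : ∀ U : Submodule ℚ (D₁.V.fiber s), (∀ γ : Path.Homotopic.Quotient s s, U.map (D₁.V.transport γ) ≤ U) → U = ⊥ ∨ U = ⊤) :
    φ.app s = 0 ∨ Function.Injective (φ.app s) := by
  rcases φ.appRat_eq_zero_or_injective_of_irreducible hirr with h | h
  · refine Or.inl (LinearMap.ext fun u => D₂.toRat_injective_holds s ?_)
    rw [← appRat_toRat, h, LinearMap.zero_apply, LinearMap.zero_apply, map_zero]
  · refine Or.inr fun u v huv => D₁.toRat_injective_holds s (h ?_)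
    rw [appRat_toRat, appRat_toRat, huv]

/-- **SCHUR (target irreducible): `(φ_s)_ℚ = 0` OR `(φ_s)_ℚ` IS SURJECTIVE.** [cite: VoisinHodgeII2003, §3.1.1 (Cor. 3.10) and Thm. 3.4] [cite: DeligneHodgeII1971, 4.2] -/
theorem Hom.appRat_eq_zero_or_surjective_of_irreducible (φ : Hom D₁ D₂) {s : S}
    (hirr : ∀ U : Submodule ℚ (D₂.V.fiber s), (∀ γ : Path.Homotopic.Quotient s s, U.map (D₂.V.transport γ) ≤ U) → U = ⊥ ∨ U = ⊤) :
    φ.appRat s = 0 ∨ Function.Surjective (φ.appRat s) := by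
  rcases hirr _ (fun γ => φ.map_transport_range_appRat_le γ) with h | h
  · exact Or.inl (LinearMap.range_eq_bot.1 h)
  · exact Or.inr (LinearMap.range_eq_top.1 h)

/-- **SCHUR (both irreducible): `(φ_s)_ℚ = 0` OR `(φ_s)_ℚ` IS A RATIONAL ISOMORPHISM `V₁,s ⥲ V₂,s`.** [cite: VoisinHodgeII2003, §3.1.1 (Cor. 3.10) and Thm. 3.4]
[cite: DeligneHodgeII1971, 4.2] -/
theorem Hom.appRat_eq_zero_or_bijective_of_irreducible (φ : Hom D₁ D₂) {s : S}
    (hirr₁ : ∀ U : Submodule ℚ (D₁.V.fiber s), (∀ γ : Path.Homotopic.Quotient s s, U.map (D₁.V.transport γ) ≤ U) → U = ⊥ ∨ U = ⊤)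
    (hirr₂ : ∀ U : Submodule ℚ (D₂.V.fiber s), (∀ γ : Path.Homotopic.Quotient s s, U.map (D₂.V.transport γ) ≤ U) → U = ⊥ ∨ U = ⊤) :
    φ.appRat s = 0 ∨ Function.Bijective (φ.appRat s) := by
  rcases φ.appRat_eq_zero_or_injective_of_irreducible hirr₁ with h | hinj
  · exact Or.inl h
  rcases φ.appRat_eq_zero_or_surjective_of_irreducible hirr₂ with h | hsurj
  · exact Or.inl h
  · exact Or.inr ⟨hinj, hsurj⟩

/-! ## §3 Path-connected base -/

/-- Vanishing of the lattice map propagates along paths (`φ_t = γ_* φ_s γ⁻¹_*`). [cite: Deligne1970, I.1, Cor. 1.4] -/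
theorem Hom.app_eq_zero_of_app_eq_zero (φ : Hom D₁ D₂) {s t : S} (γ : Path.Homotopic.Quotient s t) (h : φ.app s = 0) : φ.app t = 0 := by
  rw [← φ.transport_comp_app_comp_transport_symm γ, h, LinearMap.zero_comp, LinearMap.comp_zero]

/-- **Path-connected base, source irreducible at `s`: `φ = 0` on every lattice, OR `φ` is injective on every lattice.**
[cite: VoisinHodgeII2003, §3.1.1 (Cor. 3.10) and Thm. 3.4] [cite: Deligne1970, I.1, Cor. 1.4] -/
theorem Hom.forall_app_eq_zero_or_forall_injective_of_irreducible [PathConnectedSpace S] (φ : Hom D₁ D₂) {s : S}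
    (hirr : ∀ U : Submodule ℚ (D₁.V.fiber s), (∀ γ : Path.Homotopic.Quotient s s, U.map (D₁.V.transport γ) ≤ U) → U = ⊥ ∨ U = ⊤) :
    (∀ t : S, φ.app t = 0) ∨ ∀ t : S, Function.Injective (φ.app t) := by
  rcases φ.app_eq_zero_or_injective_of_irreducible hirr with h | h
  · exact Or.inl fun t => φ.app_eq_zero_of_app_eq_zero (Path.Homotopic.Quotient.mk (PathConnectedSpace.somePath s t)) h
  · exact Or.inr fun t => φ.injective_app_of_injective_app (Path.Homotopic.Quotient.mk (PathConnectedSpace.somePath s t)) h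

/-- **A NONZERO MORPHISM OUT OF VHS DATA WITH IRREDUCIBLE MONODROMY EMBEDS THE EXCEPTIONAL HODGE LOCI**: `exceptionalHodgeLocus D₁ p ⊆ exceptionalHodgeLocus D₂ p`
(it is injective on all lattices; sub-variation theorem, strictness). [cite: VoisinHodgeII2003, Thm. 3.4 and §5.3.1] [cite: DeligneHodgeII1971, Thm. 2.3.5 and 4.2] -/
theorem exceptionalHodgeLocus_subset_of_ne_zero_of_irreducible [PathConnectedSpace S] (φ : Hom D₁ D₂) {s : S}
    (hirr : ∀ U : Submodule ℚ (D₁.V.fiber s), (∀ γ : Path.Homotopic.Quotient s s, U.map (D₁.V.transport γ) ≤ U) → U = ⊥ ∨ U = ⊤)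
    (hne : φ.app s ≠ 0) (p : ℤ) : D₁.exceptionalHodgeLocus p ⊆ D₂.exceptionalHodgeLocus p := by
  rcases φ.forall_app_eq_zero_or_forall_injective_of_irreducible hirr with h | h
  · exact absurd (h s) hne
  · exact exceptionalHodgeLocus_subset_of_forall_injective φ h p

/-- … and Hodge-generic points of `D₂` carry only generic classes of `D₁` (level `p`, `2p = k`). [cite: VoisinHodgeII2003, §5.3.3] [cite: DeligneHodgeII1971, Thm. 2.3.5] -/
theorem hodgeGenericLocus_subset_compl_exceptionalHodgeLocus_of_ne_zero_of_irreducible [PathConnectedSpace S] (φ : Hom D₁ D₂) {s : S}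
    (hirr : ∀ U : Submodule ℚ (D₁.V.fiber s), (∀ γ : Path.Homotopic.Quotient s s, U.map (D₁.V.transport γ) ≤ U) → U = ⊥ ∨ U = ⊤)
    (hne : φ.app s ≠ 0) {p : ℤ} (hp : p + p = k) : D₂.hodgeGenericLocus ⊆ (D₁.exceptionalHodgeLocus p)ᶜ :=
  fun _ ht hmem => hodgeGenericLocus_subset_compl_exceptionalHodgeLocus_self hp ht (exceptionalHodgeLocus_subset_of_ne_zero_of_irreducible φ hirr hne p hmem)

end Motives.VHSData

end Literature.AlgebraicGeometry

end
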